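import Mathlib
import Literature.Analysis.FluidPDE.VectorCalculus
import Summits.NavierStokesRegularity.NavierStokesRegularity.Theorems.FilamentSkeletonRssNormalVariationRigidity

/-!
# Route `FilamentSkeletonRss` · crux `SelectionBoxRJ` (stmt-NavierStokesRegularity-21220) — pointwise structure of the
# slip–accretion pairing: what the swirl-directed accretion mode cannot see

Lane `ns-filament-19175-p1` (g9).  Helper file `--supports stmt-NavierStokesRegularity-21220` (line `rpi_window_split`,
stubs 2a/2b and their v5/v6 restatements; instrument record RESULTS-F2PRIME-STAGE1-21220, evidence #55 on the item).

THE OBJECTS.  Near the stagnation point `X` of a filament with tangent `t`, the accretion mode of the line file is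
`D y = φ(y) • cross t (y − X)` — a scalar times the SWIRL DIRECTION `cross t (y − X)` about the line `X + ℝt` — and the
leading part of the skeleton's regularised Biot–Savart field is an axisymmetric swirl `u y = f(q y) • cross t (y − X)`,
`q y = ‖y − X‖² − ⟪y − X, t⟫²`.  The F2′ Stage-1 table (kit j301181) found the slip functional
`S = ⟪profileOp(u_X), D̃⟫/⟪D, D̃⟫` one-signed, `≈ (0.3185 + 1.6375 − 0.32·(w′(c) − ½))·Γ`, i.e. set by the `½u` and `−Δu`
pairings of the core swirl.  This file records, kernel-checked and POINTWISE, why three of the other terms of `profileOp`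
built from the swirl alone do not pair with the mode direction at all:
* `inner_cross_swirl_swirlDir` — `⟪e × u(y), t × (y − X)⟫ = 0` for every `e` (the `α • (e₃ × u)` term);
* the shape `L w = (f₁ (2⟪y − X, w⟫ − 2⟪y − X, t⟫⟪t, w⟫)) • t × (y − X) + f₀ • t × w` of the derivative of a swirl field
  (hypothesis `hL`); from it `derivForm_inner_apply_tangent` (`⟪L w, t⟫ = 0` for all `w`: no axial component in any
  directional derivative — the v6 bookkeeping's «(W·∇)(v_θ e_θ)·t ≡ 0») and `derivForm_apply_self` / `derivForm_inner_apply_self_swirlDir` (the centripetal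
  self-advection `L (u y) = f₀² (⟪t, y − X⟫ t − ‖t‖² (y − X))` is radial–axial, hence orthogonal to the mode: the
  `(∇u) u` term of the swirl alone);
* `hasFDerivAt_swirl` — a differentiable-profile swirl HAS a derivative of that shape, so the statements apply to
  `fderiv ℝ u y` verbatim (`swirl_fderiv_inner_tangent`, `swirl_fderiv_self_inner_swirlDir`, `swirl_rot_inner_swirlDir`).
NOT claimed here: the integral-level facts (odd azimuthal harmonics of drift/tilt/strain terms vanish against the
axisymmetric weight; the values `0.3185Γ`, `1.6375Γ` of the two surviving pairings) — those stay in the instrument memo.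
HONEST FRAMING: elementary vector calculus about a HYPOTHETICAL filament proxy; nothing here bears on Navier–Stokes
regularity or blow-up.
-/

set_option linter.dupNamespace false

noncomputable section

namespace Summit.NavierStokesRegularity.NavierStokesRegularity.Theorems

open Set Function Filter Real
open Literature.Analysis.FluidPDE
open scoped InnerProductSpace Topology

namespace SelectionBoxRJSlip

/-! ### Algebra of the swirl direction `t × r` -/

/-! The basic identity `⟪a × b, a⟫ = 0` is the landed, route-independent `NormalVariationRigidity.inner_cross_self_left`
(imported; lane g3 of this seat's lineage); its mirror `⟪a × b, b⟫ = 0` (landed in a route-dependent module) is re-derived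
inline where needed, to keep this file outside the theses cone. -/

/-- The double cross product `t × (t × r) = ⟪t, r⟫ t − ‖t‖² r`. [folklore] -/
theorem cross_cross_self_left (t r : EuclideanSpace ℝ (Fin 3)) :
    cross t (cross t r) = ⟪t, r⟫_ℝ • t - (‖t‖ ^ 2) • r := by
  rw [EuclideanSpace.norm_sq_eq]
  ext i
  fin_cases i <;>
    simp [cross, crossProduct, PiLp.inner_apply, Fin.sum_univ_three, Real.norm_eq_abs, sq_abs] <;> ring

/-! ### The swirl field about a line, and the mode direction -/

/-! Below, `q y := ‖y − X‖² − ⟪y − X, t⟫²` (squared distance to the line `X + ℝt` for unit `t`) and the SWIRL field is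
written out as `f (q y) • cross t (y − X)` (the shape of the regularised Biot–Savart field of a straight filament — Rosenhead
core `f q = 2c/(q+1)` — and, with another scalar factor, of the accretion mode `D` / weighted mode `D̃` of
`Lines/rpi_window_split.lean`); no auxiliary definitions are introduced. -/

/-- The swirl is orthogonal to the axis. [folklore] -/
theorem swirl_inner_tangent (f : ℝ → ℝ) (X t y : EuclideanSpace ℝ (Fin 3)) : ⟪(f (‖y - X‖ ^ 2 - ⟪y - X, t⟫_ℝ ^ 2) • cross t (y - X)), t⟫_ℝ = 0 := by
  rw [real_inner_smul_left, NormalVariationRigidity.inner_cross_self_left, mul_zero]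

/-- The swirl is orthogonal to the radius vector. [folklore] -/
theorem swirl_inner_radial (f : ℝ → ℝ) (X t y : EuclideanSpace ℝ (Fin 3)) : ⟪(f (‖y - X‖ ^ 2 - ⟪y - X, t⟫_ℝ ^ 2) • cross t (y - X)), y - X⟫_ℝ = 0 := by
  have h : ⟪cross t (y - X), y - X⟫_ℝ = 0 := by
    simp [cross, crossProduct, PiLp.inner_apply, Fin.sum_univ_three]; ring
  rw [real_inner_smul_left, h, mul_zero]

/-- **The rotation term is invisible to the mode, pointwise**: `⟪e × u(y), t × (y − X)⟫ = 0` for every `e`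
(in `profileOp` the term is `α • cross e₃ (u y)` with `e₃ = EuclideanSpace.single 2 1`). [folklore] -/
theorem inner_cross_swirl_swirlDir (f : ℝ → ℝ) (X t e y : EuclideanSpace ℝ (Fin 3)) :
    ⟪cross e ((f (‖y - X‖ ^ 2 - ⟪y - X, t⟫_ℝ ^ 2) • cross t (y - X))), cross t (y - X)⟫_ℝ = 0 := by
  have h : ⟪cross e (cross t (y - X)), cross t (y - X)⟫_ℝ = 0 := by
    simp [cross, crossProduct, PiLp.inner_apply, Fin.sum_univ_three]; ring
  have hcs : ∀ (c : ℝ) (v : EuclideanSpace ℝ (Fin 3)), cross e (c • v) = c • cross e v := fun c v => by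
    simp [cross, map_smul]
  rw [hcs, real_inner_smul_left, h, mul_zero]

/-! ### The shape of the derivative of a swirl field, and its two blind spots -/

/-! The SHAPE of the Fréchet derivative at `y` of a swirl field about `X + ℝt` with profile value `f₀` and profile slope
`f₁` is `L w = (f₁ · (2⟪y − X, w⟫ − 2⟪y − X, t⟫⟪t, w⟫)) • t × (y − X) + f₀ • t × w`; the next three lemmas take this shape
as the hypothesis `hL` (no `Prop`-valued definition is introduced), and `hasFDerivAt_swirl` supplies it. -/

section DerivForm

variable {X t y : EuclideanSpace ℝ (Fin 3)} {f₀ f₁ : ℝ} {L : EuclideanSpace ℝ (Fin 3) →L[ℝ] EuclideanSpace ℝ (Fin 3)}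

/-- **No axial component in any directional derivative of the swirl** (`(W·∇)(v_θ e_θ)·t ≡ 0`). [folklore] -/
theorem derivForm_inner_apply_tangent
    (hL : ∀ w, L w = (f₁ * (2 * ⟪y - X, w⟫_ℝ - 2 * ⟪y - X, t⟫_ℝ * ⟪t, w⟫_ℝ)) • cross t (y - X) + f₀ • cross t w) (w : EuclideanSpace ℝ (Fin 3)) : ⟪L w, t⟫_ℝ = 0 := by
  rw [hL w, inner_add_left, real_inner_smul_left, real_inner_smul_left, NormalVariationRigidity.inner_cross_self_left,
    NormalVariationRigidity.inner_cross_self_left, mul_zero, mul_zero, add_zero]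

/-- **The self-advection of the swirl is centripetal**: on the swirl value `f₀ • t × (y − X)` itself the derivative gives
`f₀² (⟪t, y − X⟫ t − ‖t‖² (y − X))` (radial–axial; for unit `t` this is `−f₀²` times the distance vector to the line). [folklore] -/
theorem derivForm_apply_self
    (hL : ∀ w, L w = (f₁ * (2 * ⟪y - X, w⟫_ℝ - 2 * ⟪y - X, t⟫_ℝ * ⟪t, w⟫_ℝ)) • cross t (y - X) + f₀ • cross t w) :
    L (f₀ • cross t (y - X)) = (f₀ ^ 2) • (⟪t, y - X⟫_ℝ • t - (‖t‖ ^ 2) • (y - X)) := by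
  have h1 : ⟪y - X, cross t (y - X)⟫_ℝ = 0 := by
    simp [cross, crossProduct, PiLp.inner_apply, Fin.sum_univ_three]; ring
  have h2 : ⟪t, cross t (y - X)⟫_ℝ = 0 := by
    rw [real_inner_comm]; exact NormalVariationRigidity.inner_cross_self_left t (y - X)
  rw [hL, real_inner_smul_right, real_inner_smul_right, h1, h2,
    mul_zero, mul_zero, mul_zero, sub_self, mul_zero, zero_smul, zero_add]
  have hcs : ∀ (c : ℝ) (v : EuclideanSpace ℝ (Fin 3)), cross t (c • v) = c • cross t v := fun c v => by
    simp [cross, map_smul]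
  rw [hcs, smul_smul, cross_cross_self_left, pow_two, pow_two]

/-- Hence the centripetal term is orthogonal to the mode direction: `⟪L (u y), t × (y − X)⟫ = 0`. [folklore] -/
theorem derivForm_inner_apply_self_swirlDir
    (hL : ∀ w, L w = (f₁ * (2 * ⟪y - X, w⟫_ℝ - 2 * ⟪y - X, t⟫_ℝ * ⟪t, w⟫_ℝ)) • cross t (y - X) + f₀ • cross t w) :
    ⟪L (f₀ • cross t (y - X)), cross t (y - X)⟫_ℝ = 0 := by
  have h1 : ⟪y - X, cross t (y - X)⟫_ℝ = 0 := by
    simp [cross, crossProduct, PiLp.inner_apply, Fin.sum_univ_three]; ring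
  have h2 : ⟪t, cross t (y - X)⟫_ℝ = 0 := by
    rw [real_inner_comm]; exact NormalVariationRigidity.inner_cross_self_left t (y - X)
  rw [derivForm_apply_self hL, real_inner_smul_left, inner_sub_left, real_inner_smul_left, real_inner_smul_left,
    h2, h1, mul_zero, mul_zero, sub_self, mul_zero]

/-- The axial blind spot and the centripetal blind spot together: for every `w`,
`⟪L w, t⟫ = 0` and `⟪L (f₀ • t × (y − X)), t × (y − X)⟫ = 0`. [folklore] -/
theorem derivForm_blind
    (hL : ∀ w, L w = (f₁ * (2 * ⟪y - X, w⟫_ℝ - 2 * ⟪y - X, t⟫_ℝ * ⟪t, w⟫_ℝ)) • cross t (y - X) + f₀ • cross t w) (w : EuclideanSpace ℝ (Fin 3)) :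
    ⟪L w, t⟫_ℝ = 0 ∧ ⟪L (f₀ • cross t (y - X)), cross t (y - X)⟫_ℝ = 0 :=
  ⟨derivForm_inner_apply_tangent hL w, derivForm_inner_apply_self_swirlDir hL⟩

end DerivForm

/-! ### The swirl field has a derivative of that shape -/

/-- Derivative of the squared distance to the line: `D(lineDistSq X t)(y) w = 2⟪y − X, w⟫ − 2⟪y − X, t⟫⟪t, w⟫`. [folklore] -/
theorem hasFDerivAt_lineDistSq (X t y : EuclideanSpace ℝ (Fin 3)) :
    HasFDerivAt (fun y : EuclideanSpace ℝ (Fin 3) => ‖y - X‖ ^ 2 - ⟪y - X, t⟫_ℝ ^ 2)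
      ((2 : ℝ) • innerSL ℝ (y - X) - (2 * ⟪y - X, t⟫_ℝ) • innerSL ℝ t) y := by
  have hn : HasFDerivAt (fun y : EuclideanSpace ℝ (Fin 3) => ‖y - X‖ ^ 2)
      (2 • (innerSL ℝ (y - X)).comp (ContinuousLinearMap.id ℝ (EuclideanSpace ℝ (Fin 3)))) y :=
    HasFDerivAt.norm_sq ((hasFDerivAt_id y).sub_const X)
  have hi : HasFDerivAt (fun y : EuclideanSpace ℝ (Fin 3) => ⟪y - X, t⟫_ℝ) (innerSL ℝ t) y := by
    have e : (fun y : EuclideanSpace ℝ (Fin 3) => ⟪y - X, t⟫_ℝ) = fun y => innerSL ℝ t y - ⟪t, X⟫_ℝ := by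
      funext y; rw [innerSL_apply_apply, real_inner_comm, inner_sub_right]
    rw [e]
    exact (innerSL ℝ t).hasFDerivAt.sub_const _
  have hsq : HasFDerivAt (fun y : EuclideanSpace ℝ (Fin 3) => ⟪y - X, t⟫_ℝ ^ 2) ((2 * ⟪y - X, t⟫_ℝ) • innerSL ℝ t) y := by
    have hm := hi.mul hi
    have e : (fun y : EuclideanSpace ℝ (Fin 3) => ⟪y - X, t⟫_ℝ ^ 2) = fun y => ⟪y - X, t⟫_ℝ * ⟪y - X, t⟫_ℝ := by
      funext y; rw [pow_two]
    rw [e]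
    refine hm.congr_fderiv ?_
    rw [← add_smul, two_mul]
  refine (hn.sub hsq).congr_fderiv ?_
  ext w
  simp only [FunLike.coe_sub, Pi.sub_apply, FunLike.coe_smul, Pi.smul_apply, ContinuousLinearMap.coe_comp,
    innerSL_apply_apply, smul_eq_mul, nsmul_eq_mul, Nat.cast_ofNat]
  simp [innerSL_apply_apply, inner_sub_left]

/-- Derivative of `y ↦ t × (y − X)`: the constant map `w ↦ t × w` (`crossCLM t`). [folklore] -/
theorem hasFDerivAt_cross_sub (X t y : EuclideanSpace ℝ (Fin 3)) :
    HasFDerivAt (fun y : EuclideanSpace ℝ (Fin 3) => cross t (y - X)) (crossCLM t) y := by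
  have h1 : HasFDerivAt (fun y : EuclideanSpace ℝ (Fin 3) => y - X) (ContinuousLinearMap.id ℝ (EuclideanSpace ℝ (Fin 3))) y := (hasFDerivAt_id y).sub_const X
  have h2 := ((crossCLM t).hasFDerivAt (x := y - X)).comp y h1
  simpa [Function.comp_def, crossCLM_apply] using h2

/-- **The swirl field is differentiable with a derivative of the swirl shape** (profile value `f (q y)`, profile
slope `f′` at `q y = (‖y - X‖ ^ 2 - ⟪y - X, t⟫_ℝ ^ 2)`). [folklore] -/
theorem hasFDerivAt_swirl {f : ℝ → ℝ} {f' : ℝ} (X t y : EuclideanSpace ℝ (Fin 3)) (hf : HasDerivAt f f' ((‖y - X‖ ^ 2 - ⟪y - X, t⟫_ℝ ^ 2))) :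
    ∃ L : EuclideanSpace ℝ (Fin 3) →L[ℝ] EuclideanSpace ℝ (Fin 3), HasFDerivAt (fun y : EuclideanSpace ℝ (Fin 3) => f (‖y - X‖ ^ 2 - ⟪y - X, t⟫_ℝ ^ 2) • cross t (y - X)) L y ∧
      ∀ w, L w = (f' * (2 * ⟪y - X, w⟫_ℝ - 2 * ⟪y - X, t⟫_ℝ * ⟪t, w⟫_ℝ)) • cross t (y - X) +
        f ((‖y - X‖ ^ 2 - ⟪y - X, t⟫_ℝ ^ 2)) • cross t w := by
  have hq := hasFDerivAt_lineDistSq X t y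
  have hc : HasFDerivAt (fun y : EuclideanSpace ℝ (Fin 3) => f ((‖y - X‖ ^ 2 - ⟪y - X, t⟫_ℝ ^ 2)))
      (f' • ((2 : ℝ) • innerSL ℝ (y - X) - (2 * ⟪y - X, t⟫_ℝ) • innerSL ℝ t)) y :=
    hf.comp_hasFDerivAt y hq
  have hs := hc.smul (hasFDerivAt_cross_sub X t y)
  refine ⟨_, hs, ?_⟩
  intro w
  simp only [add_apply, FunLike.coe_smul, Pi.smul_apply, ContinuousLinearMap.smulRight_apply, FunLike.coe_sub,
    Pi.sub_apply, innerSL_apply_apply, crossCLM_apply, smul_eq_mul]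
  rw [add_comm]

/-- The derivative shape, stated for `fderiv`: if the profile is differentiable at `q y`, then for every `w`
`fderiv ℝ (fun y : EuclideanSpace ℝ (Fin 3) => f (‖y - X‖ ^ 2 - ⟪y - X, t⟫_ℝ ^ 2) • cross t (y - X)) y w = (f′(q y)(2⟪y − X, w⟫ − 2⟪y − X, t⟫⟪t, w⟫)) • t × (y − X) + f(q y) • t × w`. [folklore] -/
theorem swirl_fderiv_apply {f : ℝ → ℝ} (X t y : EuclideanSpace ℝ (Fin 3)) (hf : DifferentiableAt ℝ f ((‖y - X‖ ^ 2 - ⟪y - X, t⟫_ℝ ^ 2))) (w : EuclideanSpace ℝ (Fin 3)) :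
    fderiv ℝ (fun y : EuclideanSpace ℝ (Fin 3) => f (‖y - X‖ ^ 2 - ⟪y - X, t⟫_ℝ ^ 2) • cross t (y - X)) y w =
      (deriv f ((‖y - X‖ ^ 2 - ⟪y - X, t⟫_ℝ ^ 2)) * (2 * ⟪y - X, w⟫_ℝ - 2 * ⟪y - X, t⟫_ℝ * ⟪t, w⟫_ℝ)) • cross t (y - X) +
        f ((‖y - X‖ ^ 2 - ⟪y - X, t⟫_ℝ ^ 2)) • cross t w := by
  obtain ⟨L, hL, hform⟩ := hasFDerivAt_swirl X t y hf.hasDerivAt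
  rw [hL.fderiv]; exact hform w

/-- **Blind spot 1 for the swirl itself**: every directional derivative of the swirl is orthogonal to the axis,
`⟪fderiv (fun y : EuclideanSpace ℝ (Fin 3) => f (‖y - X‖ ^ 2 - ⟪y - X, t⟫_ℝ ^ 2) • cross t (y - X)) y w, t⟫ = 0`. [folklore] -/
theorem swirl_fderiv_inner_tangent {f : ℝ → ℝ} (X t y w : EuclideanSpace ℝ (Fin 3)) (hf : DifferentiableAt ℝ f ((‖y - X‖ ^ 2 - ⟪y - X, t⟫_ℝ ^ 2))) :
    ⟪fderiv ℝ (fun y : EuclideanSpace ℝ (Fin 3) => f (‖y - X‖ ^ 2 - ⟪y - X, t⟫_ℝ ^ 2) • cross t (y - X)) y w, t⟫_ℝ = 0 :=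
  derivForm_inner_apply_tangent (swirl_fderiv_apply X t y hf) w

/-- **Blind spot 2 for the swirl itself**: the self-advection `(∇u)(u)` of the swirl is orthogonal to the mode direction,
`⟪fderiv (fun y : EuclideanSpace ℝ (Fin 3) => f (‖y - X‖ ^ 2 - ⟪y - X, t⟫_ℝ ^ 2) • cross t (y - X)) y ((f (‖y - X‖ ^ 2 - ⟪y - X, t⟫_ℝ ^ 2) • cross t (y - X))), t × (y − X)⟫ = 0` — the `fderiv ℝ V y (V y)` term of `profileOp` restricted to the
core swirl does not pair with `D`, `D̃` pointwise. [folklore] -/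
theorem swirl_fderiv_self_inner_swirlDir {f : ℝ → ℝ} (X t y : EuclideanSpace ℝ (Fin 3)) (hf : DifferentiableAt ℝ f ((‖y - X‖ ^ 2 - ⟪y - X, t⟫_ℝ ^ 2))) :
    ⟪fderiv ℝ (fun y : EuclideanSpace ℝ (Fin 3) => f (‖y - X‖ ^ 2 - ⟪y - X, t⟫_ℝ ^ 2) • cross t (y - X)) y ((f (‖y - X‖ ^ 2 - ⟪y - X, t⟫_ℝ ^ 2) • cross t (y - X))), cross t (y - X)⟫_ℝ = 0 :=
  derivForm_inner_apply_self_swirlDir (swirl_fderiv_apply X t y hf)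

/-- **Blind spot 3**: the rotation term `e × u(y)` of the swirl is orthogonal to the mode direction (restated next to the
other two). [folklore] -/
theorem swirl_rot_inner_swirlDir (f : ℝ → ℝ) (X t e y : EuclideanSpace ℝ (Fin 3)) :
    ⟪cross e ((f (‖y - X‖ ^ 2 - ⟪y - X, t⟫_ℝ ^ 2) • cross t (y - X))), cross t (y - X)⟫_ℝ = 0 :=
  inner_cross_swirl_swirlDir f X t e y

end SelectionBoxRJSlip

end Summit.NavierStokesRegularity.NavierStokesRegularity.Theorems
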